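import Literature.IUT.LogVolume.HullCaseModel
import Literature.IUT.LogVolume.Xi1ModelNegativeFactors
import HarnessLib

/-!
# [IUTchIII] Remark 3.9.5 (iv) (Ξ1^non) can FAIL in the model for unequal weights (kernel witness)

Mochizuki, [IUTchIII] Rmk. 3.9.5 (iv) (Ξ1), kurims p. 128: "(Ξ1) If either of the following conditions
is satisfied, then it is easily verified that `Ξ(P) ≠ ∅`: (Ξ1^non) … the residue field extension
degree of each valuation `∈ 𝕍(K^cl)` that divides `v_ℚ ∈ 𝕍_ℚ^non` is `= 1`, and, moreover, `μ^log(P) =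
μ^log(Q)`, for some `Q ∈ Preg` which is a `ℤ_{p_{v_ℚ}}`-submodule of `𝓘^ℚ((−))`".  Here `Preg` is the
set of direct product regions — "a region that arises as a direct product of compact subsets of
positive measure in each of the direct summands" (Rmk. 3.1.1 (iii), p. 95; compact, NOT necessarily
open) — and `μ^log` on a direct product region is the weighted sum of the factor log-volumes with the
normalized weights `1/([K_v:(F_mod)_v]·Σ_w[(F_mod)_w:ℚ_{v_ℚ}])` of Rmk. 3.1.1 (ii), p. 94, which in
general DIFFER between the direct summands.

KERNEL WITNESS (this file, in the model of `HullModel.lean`/`HullCaseModel.lean`, abc-iut-S2): for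
ANY two nonarchimedean local fields `K₀, K₁` with residue field `𝔽₂` (residue degree one over `2`), the
weights `(c/2, c/3)` (`c ≠ 0`; the printed shape with `[K_{v₀}:(F_mod)_{v₀}] = 2`,
`[K_{v₁}:(F_mod)_{v₁}] = 3`), the direct product region `P = A₀ × A₁` with
`A₀ = O ∖ {‖x‖ = ‖ϖ‖ⁿ : n ≡ 3,4,5 (mod 6)}` (compact, NOT open, `μ(A₀) = 8/9` by self-similarity
`A₀ = (O ∖ m³) ⊔ ϖ⁶·A₀`), `A₁ = O ∖ ({‖x‖ = ‖ϖ‖²} ∪ m⁵)` (compact open, `μ(A₁) = 27/32`), and the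
`O_L`-submodule (a fortiori `ℤ₂`-submodule) region `Q = m_{K₀} × m_{K₁}^{-1}`: `μ^log(P) = μ^log(Q) =
−(c/6)·log 2`, `φ(P) = O × O`, and every hull `ϖ₀^{n₀}O × ϖ₁^{n₁}O ⊆ φ(P)` has `μ^log =
−c(n₀/2 + n₁/3)·log 2 ≠ −(c/6)·log 2` since `3n₀ + 2n₁ = 1` has no solution in `ℕ`.  Hence `Ξ(P) = ∅`:
`not_lt_xi1_nonempty_div_weights` refutes the layer-L6 named statement `LogThetaLattice.Xi1_nonempty`
in this instance (with the STRONGER submodule condition "`O_L`-stable additive subgroup" on `Q`, so the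
refutation is not an artefact of weakening "`ℤ_p`-submodule").  The positive results (equal weights;
printed weights on compact-open regions) are in `Xi1Model.lean`.  ERRATUM-CANDIDATE for the clause as
printed, recorded as a model-level kernel fact; Rmk. 3.9.5 (iv) lies OUTSIDE the cone of [IUTchIII]
Cor. 3.12 in the cell's DAG and nothing here bears on Cor. 3.12 or takes a side on it.
[cite: Mochizuki2012, IUTchIII Rmk. 3.9.5 (iv) p. 128] [cite: Mochizuki2012, IUTchIII Rmk. 3.1.1 (ii)(iii) pp. 94–95]
[cite: MochizukiAbsTopIII2015, Prop. 5.7 (i) p. 137]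
-/

noncomputable section

open MeasureTheory MeasureTheory.Measure Set Metric TopologicalSpace Bornology Filter
open scoped ENNReal NNReal Pointwise NormedField Topology
open Literature.NumberTheory.GaloisRepresentations.Ultrametric

namespace Literature.IUT.LogVolume


/-! ### Two factors, weights `(c/2, c/3)`: `Ξ(P) = ∅` -/

section Box

variable (K : Fin 2 → Type*) [∀ j, NontriviallyNormedField (K j)] [∀ j, IsUltrametricDist (K j)]
  [∀ j, ProperSpace (K j)] [∀ j, MeasurableSpace (K j)] [∀ j, BorelSpace (K j)]

/-- **(Ξ1^non) FAILS in the model for the printed weights `(c/2, c/3)`, `c ≠ 0`, over any two local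
fields with residue field `𝔽₂`.**  The layer-L6 named statement `LogThetaLattice.Xi1_nonempty` with
`Hul := hullSets K`, `φ := holomorphicHull K`, `μ^log := boxLogVolume K (c/2, c/3)`,
`ResidueDegreesOne := ∃ p prime, ∀ j, #(O/m) = p` (TRUE here, `p = 2`), `IsArchimedean := False`,
`IsSubmoduleRegion Q := Q` is an `O_L`-STABLE additive subgroup (stronger than `ℤ_p`-submodule),
`Preg := directProductRegions K`, is FALSE: the direct product region `P = A₀ × A₁` of this file
(`μ(A₀) = 8/9` with `A₀` compact non-open, `μ(A₁) = 27/32`) and `Q = m_{K₀} × m_{K₁}^{-1}` have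
`μ^log(P) = μ^log(Q) = −(c/6)·log 2`, `φ(P) = O × O`, and a hull `ϖ₀^{n₀}O × ϖ₁^{n₁}O ⊆ O × O` with that
log-volume would need `3n₀ + 2n₁ = 1` with `n₀, n₁ ≥ 0`.  ERRATUM-CANDIDATE for the printed clause
(which allows non-open compact factors, Rmk. 3.1.1 (iii), and unequal weights, Rmk. 3.1.1 (ii));
model-level kernel fact only; no bearing on [IUTchIII] Cor. 3.12.
[cite: Mochizuki2012, IUTchIII Rmk. 3.9.5 (iv) p. 128] [cite: Mochizuki2012, IUTchIII Rmk. 3.1.1 (ii)(iii) pp. 94–95] -/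
theorem not_lt_xi1_nonempty_div_weights (h2 : ∀ j, residueCard (K j) = 2) {c : ℝ} (hc : c ≠ 0) :
    ¬ LogThetaLattice.Xi1_nonempty (hullSets K) (holomorphicHull K)
        (boxLogVolume K (fun j => c / ((![2, 3] : Fin 2 → ℕ) j : ℝ)))
        (∃ p : ℕ, p.Prime ∧ ∀ j, residueCard (K j) = p) False
        (fun Q => (∃ G : AddSubgroup (Π j, K j), (G : Set (Π j, K j)) = Q) ∧
          ∀ a ∈ polydisc K (fun _ => (1 : ℝ)), ∀ x ∈ Q, a * x ∈ Q)
        (directProductRegions K) := by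
  classical
  intro hXi
  set w : Fin 2 → ℝ := fun j => c / ((![2, 3] : Fin 2 → ℕ) j : ℝ) with hwdef
  have hw0 : w 0 = c / 2 := by simp [hwdef]
  have hw1 : w 1 = c / 3 := by simp [hwdef]
  -- uniformizers
  have hunif : ∀ j, ∃ ϖ : (K j)ˣ, IsUniformizer ϖ := fun j => exists_isUniformizer (F := K j)
  choose ϖ hϖ using hunif
  have hlog2 : 0 < Real.log 2 := Real.log_pos one_lt_two
  -- the factors `A₀`, `A₁`
  set A : ∀ j, Set (K j) := fun j =>
    if (j : ℕ) = 0 then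
      closedBall (0 : K j) 1 \ {x : K j | ∃ n : ℕ, ‖x‖ = ‖(ϖ j : K j)‖ ^ n ∧ 3 ≤ n % 6}
    else closedBall (0 : K j) 1 \
      (sphere (0 : K j) (‖(ϖ j : K j)‖ ^ 2) ∪ closedBall (0 : K j) (‖(ϖ j : K j)‖ ^ 5)) with hAdef
  have hA0 : A 0 = closedBall (0 : K 0) 1 \
      {x : K 0 | ∃ n : ℕ, ‖x‖ = ‖(ϖ 0 : K 0)‖ ^ n ∧ 3 ≤ n % 6} := by
    simp [hAdef]
  have hA1 : A 1 = closedBall (0 : K 1) 1 \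
      (sphere (0 : K 1) (‖(ϖ 1 : K 1)‖ ^ 2) ∪ closedBall (0 : K 1) (‖(ϖ 1 : K 1)‖ ^ 5)) := by
    simp [hAdef]
  -- compactness, `1 ∈ A_j`, `A_j ⊆ O`, volumes
  have hcpt : ∀ j, IsCompact (A j) := by
    refine Fin.forall_fin_two.mpr ⟨?_, ?_⟩
    · rw [hA0]; exact (isCompact_selfSimilar_and_one_mem (K 0) (hϖ 0)).1
    · rw [hA1]; exact (localVolume_real_puncturedBall (K 1) (hϖ 1) (h2 1)).1
  have hone : ∀ j, (1 : K j) ∈ A j := by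
    refine Fin.forall_fin_two.mpr ⟨?_, ?_⟩
    · rw [hA0]; exact (isCompact_selfSimilar_and_one_mem (K 0) (hϖ 0)).2
    · rw [hA1]; exact (localVolume_real_puncturedBall (K 1) (hϖ 1) (h2 1)).2.1
  have hsubO : ∀ j, A j ⊆ closedBall (0 : K j) 1 := by
    refine Fin.forall_fin_two.mpr ⟨?_, ?_⟩
    · rw [hA0]; exact sdiff_subset
    · rw [hA1]; exact sdiff_subset
  have hvol0 : (localVolume (K 0) (A 0)).toReal = 8 / 9 := by
    rw [hA0]; exact localVolume_real_selfSimilar (K 0) (hϖ 0) (h2 0)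
  have hvol1 : (localVolume (K 1) (A 1)).toReal = 27 / 32 := by
    rw [hA1]; exact (localVolume_real_puncturedBall (K 1) (hϖ 1) (h2 1)).2.2
  have hpos : ∀ j, 0 < (unitBallStructure (K j)).haar (A j) := by
    refine Fin.forall_fin_two.mpr ⟨?_, ?_⟩
    · exact (ENNReal.toReal_pos_iff.mp (by rw [show (unitBallStructure (K 0)).haar (A 0) =
        localVolume (K 0) (A 0) from rfl, hvol0]; norm_num)).1
    · exact (ENNReal.toReal_pos_iff.mp (by rw [show (unitBallStructure (K 1)).haar (A 1) =
        localVolume (K 1) (A 1) from rfl, hvol1]; norm_num)).1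
  have hAreg : IntegralStructure.IsDirectProductRegion (fun j => unitBallStructure (K j)) A :=
    ⟨hcpt, hpos⟩
  have hneA : ∀ j, (A j).Nonempty := fun j => ⟨1, hone j⟩
  -- the subgroup region `Q = m × m⁻¹`
  set zB : Fin 2 → ℤ := ![1, -1] with hzBdef
  set uB : ∀ j, (K j)ˣ := fun j => ϖ j ^ zB j with huBdef
  set B : ∀ j, Set (K j) := fun j => closedBall (0 : K j) ‖(uB j : K j)‖ with hBdef
  have hBreg : IntegralStructure.IsDirectProductRegion (fun j => unitBallStructure (K j)) B :=
    ⟨fun j => isCompact_closedBall _ _, fun j => localVolume_closedBall_pos K j (norm_units_pos (uB j))⟩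
  have hneB : ∀ j, (B j).Nonempty := fun j => ⟨0, by simp [hBdef]⟩
  set G : AddSubgroup (Π j, K j) :=
    AddSubgroup.pi Set.univ (fun j => ((piBall (uB j) : OpenAddSubgroup (K j)) : AddSubgroup (K j)))
    with hGdef
  have hG : (G : Set (Π j, K j)) = Set.pi univ B := by
    ext x
    simp [hGdef, hBdef, AddSubgroup.mem_pi, mem_piBall]
  have hstab : ∀ a ∈ polydisc K (fun _ => (1 : ℝ)), ∀ x ∈ Set.pi univ B, a * x ∈ Set.pi univ B := by
    intro a ha x hx
    rw [mem_polydisc] at ha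
    simp only [Set.mem_univ_pi, hBdef, mem_closedBall_zero_iff] at hx ⊢
    intro j
    rw [Pi.mul_apply, norm_mul]
    exact (mul_le_of_le_one_left (norm_nonneg _) (ha j)).trans (hx j)
  -- the two weighted log-volumes
  have hvolA : boxLogVolume K w (Set.pi univ A) = -(c / 6) * Real.log 2 := by
    rw [boxLogVolume_pi K w hneA, IntegralStructure.weightedLogVolume_eq_sum, Fin.sum_univ_two, hw0, hw1,
      show (unitBallStructure (K 0)).logVolume (A 0) = Real.log (localVolume (K 0) (A 0)).toReal from rfl,
      show (unitBallStructure (K 1)).logVolume (A 1) = Real.log (localVolume (K 1) (A 1)).toReal from rfl,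
      hvol0, hvol1]
    exact weights_witness_logVolume c
  have hvolBj : ∀ j, (unitBallStructure (K j)).logVolume (B j) = -(zB j * Real.log 2) := by
    intro j
    have := localLogVolume_closedBall_zpow (K j) (hϖ j) (zB j)
    rw [h2 j] at this
    rw [show (unitBallStructure (K j)).logVolume (B j) = localLogVolume (K j) (B j) from rfl, hBdef]
    dsimp only
    rw [huBdef]
    dsimp only
    rw [Units.val_zpow_eq_zpow_val, norm_zpow]
    exact_mod_cast this
  have hvolB : boxLogVolume K w (Set.pi univ B) = -(c / 6) * Real.log 2 := by
    rw [boxLogVolume_pi K w hneB, IntegralStructure.weightedLogVolume_eq_sum, Fin.sum_univ_two, hw0, hw1,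
      hvolBj 0, hvolBj 1]
    simp [hzBdef]
    ring
  -- apply (Ξ1^non) to this `P`, `Q`
  obtain ⟨H, hH, hHsub, hHvol⟩ := hXi (Set.pi univ A) ⟨A, rfl, hAreg⟩
    (Or.inl ⟨⟨2, Nat.prime_two, h2⟩, Set.pi univ B, ⟨B, rfl, hBreg⟩, ⟨⟨G, hG⟩, hstab⟩,
      hvolA.trans hvolB.symm⟩)
  -- the hull `H = d·O_L` lies in `φ(P) = O × O`
  obtain ⟨d, rfl⟩ := exists_units_of_isHullSet K hH
  obtain ⟨cA, hcA, hφ⟩ := holomorphicHull_pi_eq_hullSet K hAreg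
  have hcA1 : ∀ j, ‖cA j‖ = 1 := fun j =>
    le_antisymm (mem_closedBall_zero_iff.mp (hsubO j (hcA j).1))
      (by simpa using (hcA j).2.2 1 (hone j))
  rw [hφ, hullSet_subset_iff] at hHsub
  set k : Fin 2 → ℤ := fun j => (hϖ j).ordFun (d j) with hkdef
  have hk : ∀ j, ‖(d j : K j)‖ = ‖(ϖ j : K j)‖ ^ k j := fun j => (hϖ j).norm_eq_zpow_ordFun (d j)
  have hk0 : ∀ j, 0 ≤ k j := fun j => by
    have := hHsub j
    rw [hcA1 j, hk j] at this
    exact (zpow_le_one_iff_right_of_lt_one₀ (norm_units_pos (ϖ j)) (hϖ j).norm_lt_one).mp this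
  -- its log-volume `−c(k₀/2 + k₁/3)·log 2` equals `−(c/6)·log 2`: impossible
  rw [hvolA, boxLogVolume_hullSet, Fin.sum_univ_two, hw0, hw1,
    mulLogVolume_of_norm_eq_zpow K 0 (hϖ 0) (hk 0), mulLogVolume_of_norm_eq_zpow K 1 (hϖ 1) (hk 1),
    h2 0, h2 1] at hHvol
  push_cast at hHvol
  have hcL : c * Real.log 2 ≠ 0 := mul_ne_zero hc hlog2.ne'
  have key : (3 * (k 0 : ℝ) + 2 * k 1 - 1) * (c * Real.log 2) = 0 := by
    linear_combination (-6 : ℝ) * hHvol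
  have hreal : (3 * (k 0 : ℝ) + 2 * k 1 - 1) = 0 := (mul_eq_zero.mp key).resolve_right hcL
  have hint : 3 * k 0 + 2 * k 1 - 1 = 0 := by exact_mod_cast hreal
  have := hk0 0
  have := hk0 1
  omega

end Box

end Literature.IUT.LogVolume

end
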